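/-
Copyright (c) 2026. All rights reserved.
Released under Apache 2.0 license as described in the file LICENSE.
-/
import Summits.AtomisticToContinuum.Crystallization.Theorems.ChartedZeroExcessLayeredLatticeLiouvilleVN

/-!
# ChartedZeroExcessLayeredLatticeLiouville — part VO «FluxOperator I»: the chain flux, the divergence identity, the discrete Green identity and
  summation by parts (decomp-a2c-lens-2, g57; helper of stmt-AtomisticToContinuum-26636, leaf (LD′) `ModalLipschitzZ`; brick (3) MODE EXTRACTION,
  critic row 929 (b))

The chain reduction of VI turns the linearised equilibrium equations of a layer-only field `φ γ α = cf α` into the block recursion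
`Σ_β chainK (0, α) β (cf β − cf α) = 0`.  This part puts the recursion in DIVERGENCE FORM and the chain energy in FLUX FORM.
* VO.1 `chainK` is odd / subtractive in its argument and vanishes off the layer window; the chain residual carried by any layer set containing the
  window is the truncated residual (`sum_chainK_eq_truncResidual`).
* VO.2 the CHAIN FLUX `chainFlux ϱ a b w T cf m := Σ_{α ∈ T, α ≤ m} Σ_{β ∈ T, m < β} chainK (0, α) β (cf β − cf α)` through the gap above layer `m`,
  carried by the layer set `T` (the layer form of VF `layerFlux`), and ★ the DIVERGENCE IDENTITY
  `chainFlux T cf m − chainFlux T cf (m − 1) = Σ_{β ∈ T} chainK (0, m) β (cf β − cf m)` (`chainFlux_sub_chainFlux`, bond reversal `chainK_swap`):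
  a layer-only field is truncated-harmonic iff its chain flux is conserved (`isTruncHarmonicZ_layerField_iff_flux`).
* VO.3 ★ the DISCRETE GREEN IDENTITY `Σ_{α, β ∈ W} chainT cf α β = −2·Σ_{α ∈ W} ⟪cf α, Σ_{β ∈ W} chainK (0, α) β (cf β − cf α)⟫`
  (`sum_chainT_eq`) and, by Abel summation (`sum_inner_sub_shift`), ★★ the FLUX FORM OF THE CHAIN ENERGY
  `chainForm c ϱ a b w S cf = 2·Σ_{m ∈ S ∪ (S − 1)} ⟪cf (m + 1) − cf m, chainFlux W cf m⟫`
  (`chainForm_eq_two_mul_sum_inner_chainFlux`): the chain form is the pairing of the INCREMENTS with the FLUXES — the identity through which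
  (b1) `chainCoercive_of_coerciveZ` becomes coercivity of the flux operator on increments (the hypothesis `hco` of VM/VN), the input of the
  window solves for (3).
-/

namespace Summit.AtomisticToContinuum.Crystallization.Theorems.ChartedZeroExcessLayeredLatticeLiouville

open Summit.AtomisticToContinuum.Crystallization.Theorems.ChartedPlanarOrderRigidityDoor (E3)
open Finset
open scoped InnerProductSpace RealInnerProductSpace BigOperators

noncomputable section FluxOperator

variable {c : ℝ} {a b : E3} {w : ℤ → E3}

/-! ### VO.1  Oddness of the chain block; the chain residual over a carrier -/

/-- `chainK` is odd in its argument. [formal bookkeeping] -/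
theorem chainK_neg (hc : 0 < c) (hL : IsLayeredCrystal c a b w) (ϱ : ℝ) (X : Cell 2 × ℤ) (β : ℤ) (u : E3) :
    chainK ϱ a b w X β (-u) = -chainK ϱ a b w X β u := by
  rw [← neg_one_smul ℝ u, chainK_smul hc hL, neg_one_smul]

/-- `chainK` is subtractive in its argument. [formal bookkeeping] -/
theorem chainK_sub (hc : 0 < c) (hL : IsLayeredCrystal c a b w) (ϱ : ℝ) (X : Cell 2 × ℤ) (β : ℤ) (u v : E3) :
    chainK ϱ a b w X β (u - v) = chainK ϱ a b w X β u - chainK ϱ a b w X β v := by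
  rw [sub_eq_add_neg, chainK_add hc hL, chainK_neg hc hL, ← sub_eq_add_neg]

/-- the chain block `chainK X β` vanishes for every layer `β` outside the layer window of `X`. [formal bookkeeping] -/
theorem chainK_eq_zero_of_not_mem_layerWindow (hc : 0 < c) (hL : IsLayeredCrystal c a b w) {ϱ : ℝ} {X : Cell 2 × ℤ} {β : ℤ}
    (hβ : β ∉ layerWindow hc hL ϱ X) (u : E3) : chainK ϱ a b w X β u = 0 := by
  have hN : ∀ Y : Cell 2 × ℤ, ‖lsite a b w Y.1 Y.2 - lsite a b w X.1 X.2‖ ≤ ϱ → Y ∈ (finite_near_lsite hc hL X ϱ).toFinset :=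
    fun _ hY => (finite_near_lsite hc hL X ϱ).mem_toFinset.mpr hY
  rw [chainK_eq_sum hN]
  refine sum_eq_zero fun Y hY => ?_
  exfalso
  refine hβ ?_
  rw [layerWindow, Finset.mem_image]
  exact ⟨Y, (Finset.mem_filter.mp hY).1, (Finset.mem_filter.mp hY).2⟩

/-- the chain residual of a profile at layer `m`, carried by ANY layer set containing the layer window of `(0, m)`, is the truncated residual of the
layer-only field at `(0, m)`. [formal bookkeeping] -/
theorem sum_chainK_eq_truncResidual (hc : 0 < c) (hL : IsLayeredCrystal c a b w) (ϱ : ℝ) (cf : ℤ → E3) {T : Finset ℤ} {m : ℤ}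
    (hT : layerWindow hc hL ϱ ((0 : Cell 2), m) ⊆ T) :
    ∑ β ∈ T, chainK ϱ a b w ((0 : Cell 2), m) β (cf β - cf m) = truncResidual ϱ a b w (fun _ α => cf α) ((0 : Cell 2), m) := by
  rw [truncResidual_layerField_eq hc hL, ← sum_subset hT fun β _ hβ => chainK_eq_zero_of_not_mem_layerWindow hc hL hβ _]

/-! ### VO.2  The chain flux and the divergence identity -/

/-- the CHAIN FLUX of the profile `cf` through the gap above layer `m`, carried by the layer set `T`:
`Σ_{α ∈ T, α ≤ m} Σ_{β ∈ T, m < β} chainK (0, α) β (cf β − cf α)` — the total linearised force exerted across the cut by the layers above it on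
one column of the layers below it. [this file, g57] -/
def chainFlux (ϱ : ℝ) (a b : E3) (w : ℤ → E3) (T : Finset ℤ) (cf : ℤ → E3) (m : ℤ) : E3 :=
  ∑ α ∈ T with α ≤ m, ∑ β ∈ T with m < β, chainK ϱ a b w ((0 : Cell 2), α) β (cf β - cf α)

/-- lowering the cut by one layer: the layers weakly below `m` are `m` and the layers strictly below. [formal bookkeeping] -/
theorem filter_le_eq_insert {T : Finset ℤ} {m : ℤ} (hm : m ∈ T) :
    (T.filter fun α => α ≤ m) = insert m (T.filter fun α => α < m) := by
  ext α
  rw [Finset.mem_filter, Finset.mem_insert, Finset.mem_filter]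
  constructor
  · rintro ⟨hαT, hαm⟩
    rcases lt_or_eq_of_le hαm with h | h
    · exact Or.inr ⟨hαT, h⟩
    · exact Or.inl h
  · rintro (rfl | ⟨hαT, hαm⟩)
    · exact ⟨hm, le_rfl⟩
    · exact ⟨hαT, hαm.le⟩

/-- the layers strictly above `m − 1` are `m` and the layers strictly above `m`. [formal bookkeeping] -/
theorem filter_pred_lt_eq_insert {T : Finset ℤ} {m : ℤ} (hm : m ∈ T) :
    (T.filter fun β => m - 1 < β) = insert m (T.filter fun β => m < β) := by
  ext β
  rw [Finset.mem_filter, Finset.mem_insert, Finset.mem_filter]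
  constructor
  · rintro ⟨hβT, hβm⟩
    rcases lt_or_eq_of_le (show m ≤ β by omega) with h | h
    · exact Or.inr ⟨hβT, h⟩
    · exact Or.inl h.symm
  · rintro (rfl | ⟨hβT, hβm⟩)
    · exact ⟨hm, by omega⟩
    · exact ⟨hβT, by omega⟩

/-- the layers weakly below `m − 1` are the layers strictly below `m`. [formal bookkeeping] -/
theorem filter_le_pred_eq (T : Finset ℤ) (m : ℤ) : (T.filter fun α => α ≤ m - 1) = T.filter fun α => α < m := by
  ext α
  rw [Finset.mem_filter, Finset.mem_filter]
  constructor
  · rintro ⟨h, h'⟩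
    exact ⟨h, by omega⟩
  · rintro ⟨h, h'⟩
    exact ⟨h, by omega⟩

/-- a sum over a layer set splits into the layers strictly below `m`, the layer `m` (if present) and the layers strictly above `m`, for a summand
vanishing at `m`. [formal bookkeeping] -/
theorem sum_eq_sum_lt_add_sum_gt {T : Finset ℤ} {m : ℤ} (f : ℤ → E3) (hf : f m = 0) :
    ∑ β ∈ T, f β = ∑ β ∈ T with β < m, f β + ∑ β ∈ T with m < β, f β := by
  rw [← sum_filter_add_sum_filter_not T (fun β => β < m) f, ← sum_filter_add_sum_filter_not (T.filter fun β => ¬β < m) (fun β => m < β) f,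
    filter_filter, filter_filter]
  have h1 : (T.filter fun β => ¬β < m ∧ m < β) = T.filter fun β => m < β :=
    filter_congr fun β _ => ⟨fun h => h.2, fun h => ⟨by omega, h⟩⟩
  have h2 : ∑ β ∈ T with ¬β < m ∧ ¬m < β, f β = 0 := by
    refine sum_eq_zero fun β hβ => ?_
    have hβm : β = m := by have := (mem_filter.mp hβ).2; omega
    rw [hβm, hf]
  rw [h1, h2, add_zero]

/-- ★ THE DIVERGENCE IDENTITY: lowering the cut from `m` to `m − 1` changes the chain flux by exactly the chain residual at layer `m`:
`chainFlux T cf m − chainFlux T cf (m − 1) = Σ_{β ∈ T} chainK (0, m) β (cf β − cf m)` (for `m ∈ T`; bond reversal `chainK_swap` turns the bonds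
entering `m` from below into residual terms). [this file, g57] -/
theorem chainFlux_sub_chainFlux (hc : 0 < c) (hL : IsLayeredCrystal c a b w) (ϱ : ℝ) (cf : ℤ → E3) {T : Finset ℤ} {m : ℤ} (hm : m ∈ T) :
    chainFlux ϱ a b w T cf m - chainFlux ϱ a b w T cf (m - 1) = ∑ β ∈ T, chainK ϱ a b w ((0 : Cell 2), m) β (cf β - cf m) := by
  have hm1 : m ∉ T.filter fun α => α < m := fun h => lt_irrefl m (Finset.mem_filter.mp h).2
  have hm2 : m ∉ T.filter fun β => m < β := fun h => lt_irrefl m (Finset.mem_filter.mp h).2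
  have e1 : chainFlux ϱ a b w T cf m = (∑ β ∈ T with m < β, chainK ϱ a b w ((0 : Cell 2), m) β (cf β - cf m)) +
      ∑ α ∈ T with α < m, ∑ β ∈ T with m < β, chainK ϱ a b w ((0 : Cell 2), α) β (cf β - cf α) := by
    unfold chainFlux
    rw [filter_le_eq_insert hm, sum_insert hm1]
  have e2 : chainFlux ϱ a b w T cf (m - 1) = (∑ α ∈ T with α < m, chainK ϱ a b w ((0 : Cell 2), α) m (cf m - cf α)) +
      ∑ α ∈ T with α < m, ∑ β ∈ T with m < β, chainK ϱ a b w ((0 : Cell 2), α) β (cf β - cf α) := by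
    unfold chainFlux
    rw [filter_le_pred_eq, filter_pred_lt_eq_insert hm, ← sum_add_distrib]
    exact sum_congr rfl fun α _ => sum_insert hm2
  have e3 : ∑ β ∈ T, chainK ϱ a b w ((0 : Cell 2), m) β (cf β - cf m) =
      (∑ β ∈ T with β < m, chainK ϱ a b w ((0 : Cell 2), m) β (cf β - cf m)) + ∑ β ∈ T with m < β, chainK ϱ a b w ((0 : Cell 2), m) β (cf β - cf m) :=
    sum_eq_sum_lt_add_sum_gt (fun β => chainK ϱ a b w ((0 : Cell 2), m) β (cf β - cf m)) (by rw [sub_self, chainK_zero hc hL])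
  have e4 : ∑ β ∈ T with β < m, chainK ϱ a b w ((0 : Cell 2), m) β (cf β - cf m) =
      -∑ α ∈ T with α < m, chainK ϱ a b w ((0 : Cell 2), α) m (cf m - cf α) := by
    rw [← sum_neg_distrib]
    refine sum_congr rfl fun α _ => ?_
    rw [chainK_swap ϱ a b w 0 0 m α, ← neg_sub (cf m) (cf α)]
    exact chainK_neg hc hL ϱ _ _ _
  rw [e1, e2, e3, e4, add_sub_add_right_eq_sub]
  abel

/-- ★ HARMONIC ⟺ FLUX CONSERVATION: a layer-only field is `ϱ`-truncated-harmonic everywhere iff, at every layer `m` and for every carrier `T ∋ m`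
containing the layer window of `(0, m)`, the chain flux through the gap above `m` equals the chain flux through the gap below it. [this file, g57] -/
theorem isTruncHarmonicZ_layerField_iff_flux (hc : 0 < c) (hL : IsLayeredCrystal c a b w) (ϱ : ℝ) (cf : ℤ → E3) :
    IsTruncHarmonicZ ϱ a b w (fun _ α => cf α) Set.univ ↔
      ∀ (m : ℤ) (T : Finset ℤ), m ∈ T → layerWindow hc hL ϱ ((0 : Cell 2), m) ⊆ T →
        chainFlux ϱ a b w T cf m = chainFlux ϱ a b w T cf (m - 1) := by
  rw [isTruncHarmonicZ_layerField_iff hc hL]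
  constructor
  · intro h m T hm hT
    rw [← sub_eq_zero, chainFlux_sub_chainFlux hc hL ϱ cf hm, sum_chainK_eq_truncResidual hc hL ϱ cf hT, truncResidual_layerField_eq hc hL]
    exact h m
  · intro h m
    have hm : m ∈ insert m (layerWindow hc hL ϱ ((0 : Cell 2), m)) := mem_insert_self _ _
    have hT : layerWindow hc hL ϱ ((0 : Cell 2), m) ⊆ insert m (layerWindow hc hL ϱ ((0 : Cell 2), m)) := subset_insert _ _
    rw [← truncResidual_layerField_eq hc hL, ← sum_chainK_eq_truncResidual hc hL ϱ cf hT, ← chainFlux_sub_chainFlux hc hL ϱ cf hm, sub_eq_zero]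
    exact h m _ hm hT

/-! ### VO.3  The discrete Green identity and the flux form of the chain energy -/

/-- ★ THE DISCRETE GREEN IDENTITY of the chain: over any finite layer set `W`,
`Σ_{α, β ∈ W} ⟪cf β − cf α, chainK (0, α) β (cf β − cf α)⟫ = −2·Σ_{α ∈ W} ⟪cf α, Σ_{β ∈ W} chainK (0, α) β (cf β − cf α)⟫`
(block symmetry `chainK_swap` and oddness; no self-adjointness is needed). [this file, g57] -/
theorem sum_chainT_eq (hc : 0 < c) (hL : IsLayeredCrystal c a b w) (ϱ : ℝ) (cf : ℤ → E3) (W : Finset ℤ) :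
    ∑ α ∈ W, ∑ β ∈ W, chainT ϱ a b w cf α β =
      -2 * ∑ α ∈ W, ⟪cf α, ∑ β ∈ W, chainK ϱ a b w ((0 : Cell 2), α) β (cf β - cf α)⟫_ℝ := by
  have h1 : ∀ α β : ℤ, chainT ϱ a b w cf α β = ⟪cf β, chainK ϱ a b w ((0 : Cell 2), α) β (cf β - cf α)⟫_ℝ -
      ⟪cf α, chainK ϱ a b w ((0 : Cell 2), α) β (cf β - cf α)⟫_ℝ := fun α β => by
    unfold chainT
    rw [inner_sub_left]
  have h2 : ∑ α ∈ W, ∑ β ∈ W, ⟪cf β, chainK ϱ a b w ((0 : Cell 2), α) β (cf β - cf α)⟫_ℝ =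
      -∑ α ∈ W, ∑ β ∈ W, ⟪cf α, chainK ϱ a b w ((0 : Cell 2), α) β (cf β - cf α)⟫_ℝ := by
    rw [sum_comm, ← sum_neg_distrib]
    refine sum_congr rfl fun α _ => ?_
    rw [← sum_neg_distrib]
    refine sum_congr rfl fun β _ => ?_
    rw [chainK_swap ϱ a b w 0 0 β α, ← neg_sub (cf β) (cf α), chainK_neg hc hL, inner_neg_right]
  simp only [h1, sum_sub_distrib]
  rw [h2]
  simp only [inner_sum]
  ring

/-- ABEL SUMMATION over `ℤ` with finite support: `Σ_{α ∈ T} ⟪g α, f α − f (α − 1)⟫ = −Σ_{α ∈ T} ⟪g (α + 1) − g α, f α⟫` whenever `T` contains the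
support of `g` and its left shift. [formal bookkeeping] -/
theorem sum_inner_sub_shift (T : Finset ℤ) (g f : ℤ → E3) (h0 : ∀ α, g α ≠ 0 → α ∈ T) (h1 : ∀ α, g (α + 1) ≠ 0 → α ∈ T) :
    ∑ α ∈ T, ⟪g α, f α - f (α - 1)⟫_ℝ = -∑ α ∈ T, ⟪g (α + 1) - g α, f α⟫_ℝ := by
  have hz : ∀ α, g (α + 1) = 0 → ⟪g (α + 1), f α⟫_ℝ = 0 := fun α h => by rw [h, inner_zero_left]
  have hA : ∑ α ∈ T, ⟪g (α + 1), f α⟫_ℝ = ∑ α ∈ T.image (fun β => β - 1), ⟪g (α + 1), f α⟫_ℝ :=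
    sum_eq_sum_of_support (fun α hα => h1 α fun h => hα (hz α h))
      (fun α hα => mem_image.mpr ⟨α + 1, h0 _ fun h => hα (hz α h), by ring⟩)
  have hB : ∑ α ∈ T.image (fun β => β - 1), ⟪g (α + 1), f α⟫_ℝ = ∑ α ∈ T, ⟪g α, f (α - 1)⟫_ℝ := by
    rw [sum_image fun x _ y _ h => by linarith]
    refine sum_congr rfl fun α _ => ?_
    rw [sub_add_cancel]
  simp only [inner_sub_right, inner_sub_left, sum_sub_distrib]
  rw [hA, hB]
  ring

/-- ★★ THE FLUX FORM OF THE CHAIN ENERGY: for a profile supported in `S` and any band-closed layer set `W ⊇ S`,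
`chainForm c ϱ a b w S cf = 2·Σ_{m ∈ S ∪ (S − 1)} ⟪cf (m + 1) − cf m, chainFlux W cf m⟫` — the chain quadratic form is the pairing of the increments with
the fluxes through the gaps (Green identity + divergence identity + Abel summation; the index set is that of `chainDirichlet`). [this file, g57] -/
theorem chainForm_eq_two_mul_sum_inner_chainFlux (hc : 0 < c) (hL : IsLayeredCrystal c a b w) {ϱ : ℝ} (cf : ℤ → E3) {S W : Finset ℤ}
    (hS : ∀ α, α ∉ S → cf α = 0) (hSW : S ⊆ W) (hW : ∀ α ∈ S, ∀ β : ℤ, c * |(((β - α : ℤ)) : ℝ)| ≤ ϱ → β ∈ W) :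
    chainForm c ϱ a b w S cf = 2 * ∑ m ∈ S ∪ S.image (fun α => α - 1), ⟪cf (m + 1) - cf m, chainFlux ϱ a b w W cf m⟫_ℝ := by
  have hT0 : ∀ α, cf α ≠ 0 → α ∈ S ∪ S.image (fun α => α - 1) := fun α hα => by
    by_contra h
    exact hα (hS α fun hαS => h (mem_union_left _ hαS))
  have hT1 : ∀ α, cf (α + 1) ≠ 0 → α ∈ S ∪ S.image (fun α => α - 1) := fun α hα => by
    by_contra h
    refine hα (hS (α + 1) fun hαS => h (mem_union_right _ (mem_image.mpr ⟨α + 1, hαS, by ring⟩)))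
  have hres : ∀ α ∈ S, ∑ β ∈ W, chainK ϱ a b w ((0 : Cell 2), α) β (cf β - cf α) =
      chainFlux ϱ a b w W cf α - chainFlux ϱ a b w W cf (α - 1) := fun α hα => (chainFlux_sub_chainFlux hc hL ϱ cf (hSW hα)).symm
  have hz : ∀ α, cf α = 0 → ∀ v : E3, ⟪cf α, v⟫_ℝ = 0 := fun α h v => by rw [h, inner_zero_left]
  rw [chainForm_eq_sum hc hL hS hSW hW, sum_chainT_eq hc hL]
  have hSsum : ∑ α ∈ W, ⟪cf α, ∑ β ∈ W, chainK ϱ a b w ((0 : Cell 2), α) β (cf β - cf α)⟫_ℝ =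
      ∑ α ∈ S, ⟪cf α, chainFlux ϱ a b w W cf α - chainFlux ϱ a b w W cf (α - 1)⟫_ℝ := by
    rw [← sum_subset hSW fun α _ hαS => hz α (hS α hαS) _]
    exact sum_congr rfl fun α hα => by rw [hres α hα]
  have hext : ∑ α ∈ S, ⟪cf α, chainFlux ϱ a b w W cf α - chainFlux ϱ a b w W cf (α - 1)⟫_ℝ =
      ∑ α ∈ S ∪ S.image (fun α => α - 1), ⟪cf α, chainFlux ϱ a b w W cf α - chainFlux ϱ a b w W cf (α - 1)⟫_ℝ :=
    sum_subset subset_union_left fun α _ hαS => hz α (hS α hαS) _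
  rw [hSsum, hext, sum_inner_sub_shift _ cf (chainFlux ϱ a b w W cf) hT0 hT1]
  ring

end FluxOperator

end Summit.AtomisticToContinuum.Crystallization.Theorems.ChartedZeroExcessLayeredLatticeLiouville
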